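import Literature.MathematicalPhysics.QuantumFieldTheory.Balaban1983to89.B13OlderTermsTableGerms

/-!
# `Balaban1983to89.B13OlderTermsTableGermsZeroClass` — T. Bałaban, *Renormalization group approach to lattice gauge field theories. I*, Commun. Math.
Phys. **109** (1987) 249–301 [Balaban1987RG1], (1.18) p. 263 with (0.23) p. 256: THE INDEX-FORM DOMINATION ROWS OF THE TABLE-GERM READING ON THE CLASS
`old 0 = 0` — the (AR-dom₁) ∕ (AR-dom₂) rows of `B13OlderTermsTableGerms` §4 WITHOUT the empty-level-0-table device

statement-level skeleton of published theorems with citation tags; proofs where landed; nothing here is a claim about the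
Yang–Mills mass gap

CITATION HEADER (verbatim).  [I] p. 256 [PDF 8], (0.23): the effective densities start at step 1 — level `0` carries no term `E^{(0)}`; p. 263 [PDF 15],
(1.18): `|E^{(j)}(X, g_{j−1}, 𝐔, 𝐉)| ≤ E₀ exp(−κ d_j(X))` on the spaces `U^c_j(X, α₀, α₁)`.

WHY (cell `pub-ymgap`, Track A node N10 [B13] → N22, seat `pub-ymgap-dag-n10-c` g20; count-neutral).  Module 105 `B13OlderTermsTableGerms` (this lane, g19) reads an
admissible family of older terms `old ∈ W1.AdmHist sp E₀ r₁ k` as the bounded weighted table `ρ sp κ bw old ∈ ℓ^∞` and proves the consumer rows (AR-adm),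
(AR-dom₁), (AR-dom₂); its §4 states the domination rows in the Summit-side INDEX form (levels `k′ + 1`, `k′ < k`) under the side condition `sp 0 Y = ∅`
(«level 0 carries no table»).  A6 FINDING (seat `pub-ymgap-dag-n22-c` g19, `Thm/BalabanUVNodesN22TermDataReadingLawsWitness` §1
`isEmpty_params_of_mapsToTables_emptyTable`, kernel-checked): that side condition, JOINTLY with def-W1's storey-17 law `(R Z t).MapsToTables sp W 𝔅` displayed by
the Summit-side modules 106 ∕ 107, forces the atom space to be EMPTY — true as stated, degenerate jointly.  The N22 junctions of record key the older terms on the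
class `old ∈ AdmHist sp E₀ r₁ k ∧ old 0 = 0` instead.  THIS FILE: the two index-form rows ON THAT CLASS — ★ `norm_ρ_sub_ρ_le_succ_of_zero`, ★
`norm_ρ_threePoint_le_succ_of_zero` — hypotheses `o 0 = 0` (each family) in place of `sp 0 Y = ∅`; the level-`0` entries of the (second) difference vanish because
the histories do, the levels `k′ + 1` are dominated as displayed; one `Fin.eq_zero_or_eq_succ` case split over module 105 §3's all-level rows.

HONEST FRAMING.  [folklore] bookkeeping; nothing of Bałaban's asserted or estimated; nodes N10 ∕ N22 NOT discharged; K-items untouched; one finite 𝕋⁴ programme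
at fixed ε — NOT continuum, NOT infinite volume, NOT OS, NOT mass gap, NOT Clay.  0 sorry, 0 `def`, standard axioms.
-/

noncomputable section

open Set Metric
open scoped BigOperators ENNReal

namespace Literature.MathematicalPhysics.QuantumFieldTheory.Balaban1983to89.B13OlderTermsTableGerms

open Literature.MathematicalPhysics.QuantumFieldTheory.Balaban1983to89
open Literature.MathematicalPhysics.QuantumFieldTheory.Balaban1983to89.Node00.Sect2 (domSys CPair)
open Literature.MathematicalPhysics.QuantumFieldTheory.Balaban1983to89.Node00.W1

variable {P : Params} {𝔸 : Type*} [NormedRing 𝔸] [NormedAlgebra ℂ 𝔸] {M : ℕ} {k : ℕ} {sp : (j : ℕ) → (domSys P M j).Dom → Set (CPair P 𝔸)}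
variable (κ : ℝ) (bw : Fin (k + 1) → ℝ)

/-! ## §1 The index-form rows on the class `old 0 = 0` — NO `sp 0 Y = ∅` side condition

A6 NOTE (seat `pub-ymgap-dag-n22-c` g19, `Thm/BalabanUVNodesN22TermDataReadingLawsWitness` §1 `isEmpty_params_of_mapsToTables_emptyTable`, kernel-checked):
module 105 §4's side condition `sp 0 Y = ∅` is harmless for the READING `ρ` alone, but JOINTLY with def-W1's storey-17 law `(R Z t).MapsToTables sp W 𝔅` (the law block
of the Summit-side modules 106 ∕ 107) it forces the atom space `S` to be EMPTY — the potentials then read no history and the package is degenerate.  The N22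
junctions of record (J68–J74) therefore key the older terms on the class `old ∈ AdmHist sp E₀ r₁ k ∧ old 0 = 0` (def-W1's run has NO level-`0` term,
`recTerm_zero`, [I] (0.23)) and use module 105 §3's ALL-LEVEL rows.  THIS FILE gives the index-form rows of module 105 §4 ON THAT CLASS: the level-`0` entries of the
difference (resp. second difference) VANISH because the histories do, so only the levels `k′ + 1`, `k′ < k`, need dominating — with NO condition on `sp 0`. -/

/-- (AR-dom₁) IN THE INDEX FORM ON THE CLASS `old 0 = 0` : for admissible `o, o′` with `o 0 = 0 = o′ 0`, domination of the weighted first differences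
at the levels `k′ + 1`, `k′ < k`, gives `‖ρ o − ρ o′‖ ≤ B` — NO `sp 0 Y = ∅` hypothesis. [cite: Balaban1987RG1, (1.18) p.263 and (0.23) p.256] -/
theorem norm_ρ_sub_ρ_le_succ_of_zero (hsp : ∀ (j : ℕ) (Y : (domSys P M j).Dom), IsOpen (sp j Y))
    {E₀ r₁ Bw : ℝ} (hκ : κ ≤ r₁) (hE₀ : 0 ≤ E₀) (hbw0 : ∀ j, 0 ≤ bw j) (hbw : ∀ j, bw j ≤ Bw) {o o' : OlderTerms P 𝔸 M k}
    (ho : o ∈ AdmHist sp E₀ r₁ k) (ho' : o' ∈ AdmHist sp E₀ r₁ k) (ho0 : o 0 = 0) (ho0' : o' 0 = 0) {B : ℝ} (hB : 0 ≤ B)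
    (h : ∀ (k' : ℕ) (hk' : k' < k) (Y : (domSys P M (k' + 1)).Dom), ∀ ψ ∈ sp (k' + 1) Y,
      bw ⟨k' + 1, Nat.succ_lt_succ hk'⟩ *
        (Real.exp (κ * (domSys P M (k' + 1)).dj Y) * ‖o ⟨k' + 1, Nat.succ_lt_succ hk'⟩ Y ψ - o' ⟨k' + 1, Nat.succ_lt_succ hk'⟩ Y ψ‖) ≤ B) :
    ‖ρ sp κ bw o - ρ sp κ bw o'‖ ≤ B := by
  refine norm_ρ_sub_ρ_le κ bw hsp hκ hE₀ hbw0 hbw ho ho' hB fun j Y ψ hψ => ?_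
  rcases Fin.eq_zero_or_eq_succ j with rfl | ⟨j', rfl⟩
  · have e : o 0 Y ψ - o' 0 Y ψ = 0 := by rw [ho0, ho0']; simp
    rw [e, norm_zero, mul_zero, mul_zero]
    exact hB
  · exact h j'.1 j'.2 Y ψ hψ

/-- (AR-dom₂) IN THE INDEX FORM ON THE CLASS `old 0 = 0` : for admissible `o₁, o₂, o₃` vanishing at level `0`, domination of the weighted second
differences at the levels `k′ + 1`, `k′ < k`, gives `‖ρ o₁ − 2ρ o₂ + ρ o₃‖ ≤ B` — NO `sp 0 Y = ∅` hypothesis. [cite: Balaban1987RG1, (1.18) p.263 and (0.23) p.256] -/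
theorem norm_ρ_threePoint_le_succ_of_zero (hsp : ∀ (j : ℕ) (Y : (domSys P M j).Dom), IsOpen (sp j Y))
    {E₀ r₁ Bw : ℝ} (hκ : κ ≤ r₁) (hE₀ : 0 ≤ E₀) (hbw0 : ∀ j, 0 ≤ bw j) (hbw : ∀ j, bw j ≤ Bw) {o₁ o₂ o₃ : OlderTerms P 𝔸 M k}
    (h₁ : o₁ ∈ AdmHist sp E₀ r₁ k) (h₂ : o₂ ∈ AdmHist sp E₀ r₁ k) (h₃ : o₃ ∈ AdmHist sp E₀ r₁ k)
    (h₁0 : o₁ 0 = 0) (h₂0 : o₂ 0 = 0) (h₃0 : o₃ 0 = 0) {B : ℝ} (hB : 0 ≤ B)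
    (h : ∀ (k' : ℕ) (hk' : k' < k) (Y : (domSys P M (k' + 1)).Dom), ∀ ψ ∈ sp (k' + 1) Y,
      bw ⟨k' + 1, Nat.succ_lt_succ hk'⟩ *
        (Real.exp (κ * (domSys P M (k' + 1)).dj Y) *
          ‖o₁ ⟨k' + 1, Nat.succ_lt_succ hk'⟩ Y ψ - 2 * o₂ ⟨k' + 1, Nat.succ_lt_succ hk'⟩ Y ψ + o₃ ⟨k' + 1, Nat.succ_lt_succ hk'⟩ Y ψ‖) ≤ B) :
    ‖ρ sp κ bw o₁ - (2 : ℂ) • ρ sp κ bw o₂ + ρ sp κ bw o₃‖ ≤ B := by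
  refine norm_ρ_threePoint_le κ bw hsp hκ hE₀ hbw0 hbw h₁ h₂ h₃ hB fun j Y ψ hψ => ?_
  rcases Fin.eq_zero_or_eq_succ j with rfl | ⟨j', rfl⟩
  · have e : o₁ 0 Y ψ - 2 * o₂ 0 Y ψ + o₃ 0 Y ψ = 0 := by rw [h₁0, h₂0, h₃0]; simp
    rw [e, norm_zero, mul_zero, mul_zero]
    exact hB
  · exact h j'.1 j'.2 Y ψ hψ

end Literature.MathematicalPhysics.QuantumFieldTheory.Balaban1983to89.B13OlderTermsTableGerms

end
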